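import Literature.NumberTheory.EllipticCurves.SubgroupSelmerCocycleCriteriaProofs
import Mathlib.GroupTheory.Index
import Mathlib.Topology.Algebra.OpenSubgroup
import Mathlib.Tactic.Group
import HarnessLib

/-!
# Road α, crux `PrintCf2.SplitBadTwoRankOneOfFacts` (stmt-BirchSwinnertonDyer-20368), brick (RES)(b2-ii), file 1/3: COCYCLES OF A SIGN MODULE WITH A
# MOVER — a continuous 1-cocycle principal on a commutator-containing, trivially-acting `N` is principal (pure topological group cohomology)

Cell `bsd-print-cf2`, width seat `bsd-line-cf2-p1-w6` g4; `--supports stmt-BirchSwinnertonDyer-20368 --as helper`. HONEST FRAMING: nothing here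
closes the crux or a registered stub; no summit statement is proved by this seat; BSD is not proved by any of this. No definition, no named
fact, no `sorry`.

Setting of (RES)(b2) (cf2c-w8 g0's TURNKEY `Cruxes/RestrictedMainConjWithValueAtTwo/RES-LOCAL-DEFECT-cf2c-w8.md` §2 (V̄), corrected by p685012):
over the line `K*_∞ = K̄^{ker κ₂}` the Greenberg group `S_{W*}(K*_∞)` (= `J`, p685638) and Agboola's `𝔖_v̄(K*_∞, W*)` differ ABOVE `v̄` by
`Def(v̄) = ker (H¹(ker κ₂ ⊓ D_v̄, W*) → H¹(ker κ₂ ⊓ I_v̄, W*))`; by (C3) `ker κ₂` acts on `W*` through `{±1}`. `Def(v̄) = 0` exactly when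
`ker κ₂ ⊓ I_v̄` acts trivially on `W*` and some `δ₀ ∈ ker κ₂ ⊓ D_v̄` acts as `−1` («mover outside inertia»: road α `d ≡ 7 (mod 8)`, `d ≡ 6 (mod 16)`);
`Def(v̄) ≅ ℤ/2` for an inertial mover (`d ≡ 2, 10 (mod 16)`); `Def(v̄) ⊇ Hom_cont(Ẑ, W*) ≅ ℚ₂/ℤ₂` when `ker κ₂ ⊓ D_v̄` acts trivially
(`d ≡ 3 (mod 8)`, `d ≡ 14 (mod 16)`).

THIS FILE (generic, any topological group `G`, any discrete `G`-module `M`): `smul_eq_self_of_two_nsmul_eq_zero`,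
`continuous_smul_const_of_isOpen_stabilizer`, and **`exists_eq_smul_sub_of_mover`** — `G` acting on `M` through signs (`g • m = ± m`), `N ≤ G` acting
trivially and containing all commutators, a mover `δ₀` (`δ₀ • m = −m`), `M` `2`-divisible with at most one element of order `2`, open stabilisers, and
(U′) «any two open subgroups of index `2` containing `N` coincide»: every continuous 1-cocycle `z` with `z|_N` principal is principal. Proof:
commutators in `N` give `(1 − ε(h)) w(g) = (1 − ε(g)) w(h)` for `w = z − ∂m₀`; with `h = δ₀` and `2 m₁ = w(δ₀)`, `w + ∂m₁` is a continuous homomorphism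
to `M[2] ≅ ℤ/2` killing `N` and `δ₀`; were it non-zero, by (U′) its kernel would be the stabiliser of a point of order `4`, which misses `δ₀`.
Files 2/3 (`…LineLocalGroupAtRamified`: `Γ_F/I_F` abelian, `H_F·I_F` open for a ramified line, (U′) for `H_F`) and 3/3 (`…LineLocalDefectVbarMover`:
transport to `Γ_K`, `greenbergKer (M⁺ = 0) = awayKer`) complete the brick.

presearch: Serre, Galois Cohomology I §2.4, §5 (crossed homomorphisms); Greenberg LNM 1716 §3; Rubin LNM 1716 §3 Lemma 3.6 (ii) — held; no tree lemma
of this shape (`lean search 'principal.*index_two|cocycle.*sign'`: none). beyond-print theorem: no.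

References: [SerreGaloisCohomology1997] I §2.4, I §5.1; [GreenbergLNM1716] §3; [Rubin1999] §3 Lemma 3.6 (ii).
-/

set_option autoImplicit false
set_option linter.dupNamespace false

noncomputable section

open scoped Classical Pointwise
open Multiplicative
open Literature.NumberTheory.EllipticCurves Literature.NumberTheory.GaloisRepresentations

namespace Summit.BirchSwinnertonDyer.BirchSwinnertonDyer.Theorems.PrintCf2.LineLocallyTrivial

/-! ## §1. Sign modules with a mover: cocycles principal on `N` are principal -/

section Mover

variable {G : Type} [Group G] [TopologicalSpace G] [IsTopologicalGroup G]
  {M : Type} [AddCommGroup M] [DistribMulAction G M] [TopologicalSpace M] [DiscreteTopology M]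

omit [TopologicalSpace G] [IsTopologicalGroup G] [TopologicalSpace M] [DiscreteTopology M] in
/-- In a sign module an element killed by `2` is fixed by everything. [folklore] -/
theorem smul_eq_self_of_two_nsmul_eq_zero (hpm : ∀ g : G, (∀ m : M, g • m = m) ∨ (∀ m : M, g • m = -m)) (g : G) {x : M}
    (hx : (2 : ℕ) • x = 0) : g • x = x := by
  rcases hpm g with h | h
  · exact h x
  · rw [h x, neg_eq_iff_add_eq_zero, ← two_nsmul, hx]

omit [TopologicalSpace M] [DiscreteTopology M] in
/-- Orbit maps of a module with open stabilisers are continuous for the discrete topology on `M`. [cite: SerreGaloisCohomology1997, II §1] -/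
theorem continuous_smul_const_of_isOpen_stabilizer (hstab : ∀ m : M, IsOpen (MulAction.stabilizer G m : Set G)) (m : M) :
    @Continuous G M _ ⊥ fun g : G ↦ g • m := by
  letI : TopologicalSpace M := ⊥
  refine continuous_def.mpr fun U _ ↦ ?_
  have : (fun g : G ↦ g • m) ⁻¹' U = ⋃ n ∈ U, {g : G | g • m = n} := by ext g; simp
  rw [this]
  refine isOpen_biUnion fun n _ ↦ ?_
  by_cases hne : {g : G | g • m = n}.Nonempty
  · obtain ⟨g₀, hg₀⟩ := hne
    have heq : {g : G | g • m = n} = (fun g ↦ g₀⁻¹ * g) ⁻¹' (MulAction.stabilizer G m : Set G) := by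
      ext g
      simp only [Set.mem_setOf_eq, Set.mem_preimage, SetLike.mem_coe, MulAction.mem_stabilizer_iff]
      rw [mul_smul, inv_smul_eq_iff, hg₀]
    rw [heq]
    exact (hstab m).preimage (continuous_const.mul continuous_id)
  · rw [Set.not_nonempty_iff_eq_empty.mp hne]
    exact isOpen_empty

/-- **Cocycles of a sign module with a mover outside `N`, principal on `N`, are principal.** `G` a topological group, `M` a discrete
`G`-module on which every element acts as `+1` or `−1`, `N ≤ G` acting trivially and containing all commutators, `δ₀ ∈ G` acting as `−1`,
`M` `2`-divisible with at most one element of order `2`, open stabilisers, and (U′): any two open subgroups of index `2` containing `N`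
coincide. Then every continuous crossed homomorphism `z : G → M` with `z|_N = ∂m₀` is principal. [cite: SerreGaloisCohomology1997, I §2.4]
[cite: GreenbergLNM1716, §3] -/
theorem exists_eq_smul_sub_of_mover (N : Subgroup G) (hN : ∀ n ∈ N, ∀ m : M, n • m = m) (hcomm : ∀ g h : G, g * h * g⁻¹ * h⁻¹ ∈ N)
    (hpm : ∀ g : G, (∀ m : M, g • m = m) ∨ (∀ m : M, g • m = -m)) {δ₀ : G} (hδ₀ : ∀ m : M, δ₀ • m = -m)
    (hdiv : ∀ m : M, ∃ m' : M, (2 : ℕ) • m' = m) (h2 : ∀ x y : M, (2 : ℕ) • x = 0 → (2 : ℕ) • y = 0 → x ≠ 0 → y ≠ 0 → x = y)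
    (hstab : ∀ m : M, IsOpen (MulAction.stabilizer G m : Set G))
    (hU : ∀ U₁ U₂ : Subgroup G, IsOpen (U₁ : Set G) → IsOpen (U₂ : Set G) → N ≤ U₁ → N ≤ U₂ → U₁.index = 2 → U₂.index = 2 → U₁ = U₂)
    (z : contOneCocycles (discreteTopRep G M)) {m₀ : M} (hzN : ∀ n ∈ N, z.1 n = n • m₀ - m₀) :
    ∃ n : M, ∀ g : G, z.1 g = g • n - n := by
  have hz : ∀ g h : G, z.1 (g * h) = z.1 g + g • z.1 h := fun g h ↦ z.2 g h
  have hzc : Continuous z.1 := z.1.continuous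
  have hdisc : (inferInstance : TopologicalSpace M) = ⊥ := DiscreteTopology.eq_bot
  have horb : ∀ m : M, Continuous fun g : G ↦ g • m := fun m ↦ by
    have h := continuous_smul_const_of_isOpen_stabilizer hstab m
    rwa [← hdisc] at h
  have hgn : ∀ (g : G) (m : M), g • ((2 : ℕ) • m) = (2 : ℕ) • (g • m) := fun g m ↦ smul_comm g (2 : ℕ) m
  -- Step 1: `w := z − ∂m₀` vanishes on `N`
  set w : G → M := fun g ↦ z.1 g - (g • m₀ - m₀) with hw_def
  have hw : ∀ g h : G, w (g * h) = w g + g • w h := by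
    intro g h
    simp only [hw_def, hz, mul_smul, smul_sub]
    abel
  have hwN : ∀ n ∈ N, w n = 0 := fun n hn ↦ by simp only [hw_def, hzN n hn, sub_self]
  have hwc : Continuous w := hzc.sub ((horb m₀).sub continuous_const)
  -- Step 2: the commutator identity, read with `h = δ₀`: `2 • w g = w δ₀ − g • w δ₀`
  have hwNmul : ∀ n ∈ N, ∀ g : G, w (n * g) = w g := fun n hn g ↦ by rw [hw, hwN n hn, hN n hn, zero_add]
  have hcommw : ∀ g h : G, w g + g • w h = w h + h • w g := by
    intro g h
    have h1 : g * h = (g * h * g⁻¹ * h⁻¹) * (h * g) := by group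
    have h2 : w (g * h) = w (h * g) := by rw [h1, hwNmul _ (hcomm g h)]
    rwa [hw, hw] at h2
  have htwo : ∀ g : G, (2 : ℕ) • w g = w δ₀ - g • w δ₀ := by
    intro g
    have h := hcommw g δ₀
    rw [hδ₀] at h
    rw [two_nsmul]
    have h' : w g + g • w δ₀ + w g = w δ₀ := by rw [h]; abel
    calc w g + w g = (w g + g • w δ₀ + w g) - g • w δ₀ := by abel
      _ = w δ₀ - g • w δ₀ := by rw [h']
  -- Step 3: renormalise by `m₁` with `2 m₁ = w δ₀`: `w' := w + ∂m₁` kills `N` and `δ₀` and is `2`-torsion valued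
  obtain ⟨m₁, hm₁⟩ := hdiv (w δ₀)
  set w' : G → M := fun g ↦ w g + (g • m₁ - m₁) with hw'_def
  have hw' : ∀ g h : G, w' (g * h) = w' g + g • w' h := by
    intro g h
    simp only [hw'_def, hw, mul_smul, smul_add, smul_sub]
    abel
  have hw'N : ∀ n ∈ N, w' n = 0 := fun n hn ↦ by simp only [hw'_def, hwN n hn, hN n hn, sub_self, add_zero]
  have hw'c : Continuous w' := hwc.add ((horb m₁).sub continuous_const)
  have hw'δ₀ : w' δ₀ = 0 := by
    simp only [hw'_def, hδ₀]
    rw [← hm₁, two_nsmul]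
    abel
  have hw'two : ∀ g : G, (2 : ℕ) • w' g = 0 := by
    intro g
    simp only [hw'_def]
    rw [nsmul_add, htwo g, nsmul_sub, ← hgn, hm₁]
    abel
  -- Step 4: `w'` is a continuous homomorphism to `M[2]`, killing `N` and `δ₀`
  have hw'add : ∀ g h : G, w' (g * h) = w' g + w' h := fun g h ↦ by
    rw [hw', smul_eq_self_of_two_nsmul_eq_zero hpm g (hw'two h)]
  have hw'one : w' 1 = 0 := by
    have h := hw'add 1 1
    rw [mul_one] at h
    exact left_eq_add.mp h
  -- Step 5: `w' = 0`
  have hw'zero : ∀ g : G, w' g = 0 := by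
    by_contra hcon
    push Not at hcon
    obtain ⟨g₁, hg₁⟩ := hcon
    let U₁ : Subgroup G :=
      { carrier := {g | w' g = 0}
        one_mem' := hw'one
        mul_mem' := fun {a b} ha hb ↦ by
          simp only [Set.mem_setOf_eq] at ha hb ⊢
          rw [hw'add, ha, hb, add_zero]
        inv_mem' := fun {a} ha ↦ by
          simp only [Set.mem_setOf_eq] at ha ⊢
          have h := hw'add a⁻¹ a
          rw [inv_mul_cancel, hw'one, ha, add_zero] at h
          exact h.symm }
    have hU₁mem : ∀ g, g ∈ U₁ ↔ w' g = 0 := fun _ ↦ Iff.rfl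
    have hU₁o : IsOpen (U₁ : Set G) := hw'c.isOpen_preimage {0} (isOpen_discrete _)
    have hNU₁ : N ≤ U₁ := fun n hn ↦ (hU₁mem n).mpr (hw'N n hn)
    have hU₁i : U₁.index = 2 := by
      rw [Subgroup.index_eq_two_iff]
      refine ⟨g₁, fun b ↦ ?_⟩
      rw [hU₁mem, hU₁mem, hw'add]
      by_cases hb : w' b = 0
      · rw [hb, zero_add]
        exact Or.inr ⟨rfl, hg₁⟩
      · refine Or.inl ⟨?_, hb⟩
        rw [h2 (w' b) (w' g₁) (hw'two b) (hw'two g₁) hb hg₁, ← two_nsmul, hw'two]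
    -- a point `m₂` of order not dividing `2`
    obtain ⟨m₂, hm₂⟩ := hdiv (w' g₁)
    have hm₂' : (2 : ℕ) • m₂ ≠ 0 := by rw [hm₂]; exact hg₁
    let U₂ : Subgroup G := MulAction.stabilizer G m₂
    have hNU₂ : N ≤ U₂ := fun n hn ↦ MulAction.mem_stabilizer_iff.mpr (hN n hn m₂)
    have hU₂i : U₂.index = 2 := by
      rw [Subgroup.index_eq_two_iff]
      refine ⟨δ₀, fun b ↦ ?_⟩
      simp only [U₂, MulAction.mem_stabilizer_iff, mul_smul, hδ₀, smul_neg]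
      rcases hpm b with hb | hb
      · rw [hb m₂]
        exact Or.inr ⟨rfl, fun h ↦ hm₂' (by rw [two_nsmul]; exact neg_eq_iff_add_eq_zero.mp h)⟩
      · rw [hb m₂, neg_neg]
        exact Or.inl ⟨rfl, fun h ↦ hm₂' (by rw [two_nsmul]; exact neg_eq_iff_add_eq_zero.mp h)⟩
    have hEq := hU U₁ U₂ hU₁o (hstab m₂) hNU₁ hNU₂ hU₁i hU₂i
    have hδU₁ : δ₀ ∈ U₁ := (hU₁mem δ₀).mpr hw'δ₀
    rw [hEq] at hδU₁
    have h := MulAction.mem_stabilizer_iff.mp hδU₁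
    rw [hδ₀] at h
    exact hm₂' (by rw [two_nsmul]; exact neg_eq_iff_add_eq_zero.mp h)
  -- Step 6: read off the principal part
  refine ⟨m₀ - m₁, fun g ↦ ?_⟩
  have h := hw'zero g
  simp only [hw'_def, hw_def] at h
  rw [smul_sub]
  -- `z g − (g m₀ − m₀) + (g m₁ − m₁) = 0`
  have : z.1 g = (g • m₀ - m₀) - (g • m₁ - m₁) := by
    rw [← sub_eq_zero]
    rw [← h]
    abel
  rw [this]
  abel

end Mover


end Summit.BirchSwinnertonDyer.BirchSwinnertonDyer.Theorems.PrintCf2.LineLocallyTrivial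

end
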